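import Summits.Langlands.Langlands.Theses.PicardMuOrdinary
import Summits.Langlands.Langlands.Theorems.IrreducibilityBySelfDualityReciprocityUpToIrreducibilityWeakAutomorphy
import Summits.Langlands.Langlands.Theorems.PicardMuOrdinaryIrregularClassicalityIrregularDescentUntwist
import Literature.NumberTheory.GaloisRepresentations.PicardCurveGaloisRepDeRham
import Literature.NumberTheory.GaloisRepresentations.PicardLambdaAdicRepChebotarev
import Literature.FieldTheory.AlgClosed.PadicAlgClEquivComplex
import HarnessLib

/-!
# Route `PicardMuOrdinary` (stmt-Langlands-13756/13758): the TARGET `PicardAutomorphy` is the summit `Langlands` read on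
# the Picard representation — `X ⇐ Langlands + F1` (calibration of the target's conventions)

Continuation lead prover-line-stmt-Langlands-13758-c16-0, 2026-08-17.  The route's target X (`PicardAutomorphy`: for
generic `f`, a cuspidal L-algebraic `π` on `GL₃(𝔸_{ℚ(ω)})` with `ΣSat(π, 𝔭) = e(a_𝔭(f))` a.e.) carries two conventions
the target's own `why_might_fail` flags as the only refutation room "as typed": the SIGN of `a_𝔭 = picardTrace` and the
normalisation "`Σα` = trace of an L-algebraic `π`".  This file checks them kernel-side against the summit: X follows from
`_root_.Langlands` (through its weak-automorphy consequence B_w, `ReciprocityUpToIrreducibility.stub_weakAutomorphy_of_langlands`,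
direction (B) minus local–global compatibility) and the geometric fact F1
(`picardCurve_exists_lambdaAdicRep_isDeRhamFramed`: the `λ`-adic Picard representation `ρ_C` with geometric-Frobenius
traces `j(a_𝔭)`, absolutely irreducible for generic `f`, de Rham at `λ`).  Proof: fix `ι : ℚ̄₃ ≃ ℂ` and `e : K → ℂ`, take
`ρ_C` through `j = ι⁻¹ ∘ e`; it is irreducible, unramified off the finitely many bad places (`picard_setOf_badPlace_finite`)
and pinned-de Rham above `3`, so B_w gives an L-algebraic cuspidal `π` with `charpoly ρ_C(Frob_𝔭) = arithFrobPolyOfSatake ι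
N𝔭 1 α` a.e.; then `tr ρ_C(Frob_𝔭⁻¹) = ι⁻¹(Σα)` (`m = 1`, `trace_inv_eq_of_hasFrobCharpolyAt_one`) and `= ι⁻¹ e(a_𝔭)` give
`Σα = e(a_𝔭)`.  Had the target's sign or normalisation been off, this would not type-check.  Consequently the whole
chain `crux ⇐ C3♮ ⇐ X ⇐ Langlands + F1` (`irregularClassicalityEssPolarized_of_picardAutomorphy`, p163193) is
kernel-checked.  Nothing here closes any item.

References: J.-M. Fontaine, B. Mazur (1995) Conj. 1; K. Buzzard, T. Gee (2014) Conj. 3.2.1–3.2.2 and Rem. 3.2.5;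
C. Upton, J. Algebra 322 (2009) Thm. 2.1; G. Faltings (1989).
(buildfix 2026-08-20: comment-only re-land to re-enqueue the module build after its import
`…ReciprocityUpToIrreducibilityWeakAutomorphy` was repaired (p203910); no declaration changed.)
-/

open Literature.NumberTheory.GaloisRepresentations Literature.NumberTheory.Automorphic
open Literature.NumberTheory
open scoped NumberField
open IsDedekindDomain NumberField Polynomial Filter Field

-- `Summit.Langlands.Langlands.…` (summit = sub-problem name, D-0017 layout) trips `dupNamespace` on every decl.
set_option linter.dupNamespace false
set_option autoImplicit false

namespace Summit.Langlands.Langlands.Theorems.IrregularClassicality.SlopeFreePolarizedLimit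

noncomputable section

/-- **The target `PicardAutomorphy` from the summit `Langlands` and F1** (calibration of the target's sign of `a_𝔭` and of
its L-algebraic `Σα` normalisation against the summit's `SatakeFrobCompatibleAt`, `m = 1`): for generic `f` the Picard
representation `ρ_C` of F1 (irreducible, unramified a.e., de Rham at `λ`) is automorphic by B_w, and the Frobenius–Satake
compatibility reads `ΣSat(π, 𝔭) = e(a_𝔭(f))` a.e. [cite: FontaineMazurGeometric1995, Conj. 1]
[cite: BuzzardGeeLMS2014, Conj. 3.2.2 and Rem. 3.2.5] -/
theorem picardAutomorphy_of_langlands :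
    Literature.NumberTheory.GaloisRepresentations.picardCurve_exists_lambdaAdicRep_isDeRhamFramed → _root_.Langlands →
      Summit.Langlands.Langlands.Theses.PicardMuOrdinary.PicardAutomorphy := by
  intro hF1 hL f hcpt hdeg hsep hgal
  classical
  haveI : Fact (Nat.Prime 3) := ⟨Nat.prime_three⟩
  -- fix `ι : ℚ̄₃ ≃ ℂ` and a complex embedding `e` of `K = ℚ(ω)`
  obtain ⟨ι⟩ := PadicAlgCl.nonempty_ringEquiv_complex 3
  have he : Nonempty ((CyclotomicField 3 ℚ) →+* ℂ) := by
    rw [← Fintype.card_pos_iff, NumberField.Embeddings.card]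
    exact Module.finrank_pos
  obtain ⟨e⟩ := he
  -- F1: the Picard representation through `j = ι⁻¹ ∘ e`
  obtain ⟨ρ, hρ, hirr, hdR⟩ := hF1 f hdeg hsep (ι.symm.toRingHom.comp e)
  have habs : FramedRep.IsAbsolutelyIrreducible ρ := hirr hgal
  -- unramified off the finitely many bad places
  set Bad : Set (HeightOneSpectrum (𝓞 (CyclotomicField 3 ℚ))) :=
    {v | ¬ ((3 : 𝓞 (CyclotomicField 3 ℚ)) ∉ v.asIdeal ∧
      (f.map ((Ideal.Quotient.mk v.asIdeal).comp (algebraMap ℤ (𝓞 (CyclotomicField 3 ℚ))))).natDegree = 4 ∧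
      (f.map ((Ideal.Quotient.mk v.asIdeal).comp (algebraMap ℤ (𝓞 (CyclotomicField 3 ℚ))))).Separable)}
    with hBad
  have hBadfin : Bad.Finite := picard_setOf_badPlace_finite f hdeg hsep
  have hgood : ∀ v ∉ Bad, (3 : 𝓞 (CyclotomicField 3 ℚ)) ∉ v.asIdeal ∧
      (f.map ((Ideal.Quotient.mk v.asIdeal).comp (algebraMap ℤ (𝓞 (CyclotomicField 3 ℚ))))).natDegree = 4 ∧
      (f.map ((Ideal.Quotient.mk v.asIdeal).comp (algebraMap ℤ (𝓞 (CyclotomicField 3 ℚ))))).Separable := by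
    intro v hv
    by_contra h
    exact hv h
  have hunr : ∀ᶠ v : HeightOneSpectrum (𝓞 (CyclotomicField 3 ℚ)) in cofinite, ρ.IsUnramifiedAt v :=
    Filter.eventually_of_mem hBadfin.compl_mem_cofinite fun v hv =>
      (hρ v (hgood v hv).1 (hgood v hv).2.1 (hgood v hv).2.2).1
  -- B_w at (ℚ(ω), 3, 3)
  obtain ⟨π, hLalg, hcompat⟩ :=
    ReciprocityUpToIrreducibility.stub_weakAutomorphy_of_langlands hL (CyclotomicField 3 ℚ) 3 hcpt (by norm_num) 3 ι ρ
      habs.isIrreducible ⟨hunr, hdR⟩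
  refine ⟨e, π, hLalg, ?_⟩
  filter_upwards [hcompat, hBadfin.compl_mem_cofinite] with 𝔭 h𝔭 h𝔭good
  obtain ⟨α, hsat, -, hchar⟩ := h𝔭
  obtain ⟨𝔓, h𝔓⟩ := 𝔭.primesAbove_nonempty
  obtain ⟨τ, hτ⟩ := HeightOneSpectrum.exists_isArithFrobAt_of_mem_primesAbove_holds h𝔓
  have h1 := Summit.Langlands.Langlands.Theorems.IrregularClassicality.SplitRamifiedPrimeSqrt6.trace_inv_eq_of_hasFrobCharpolyAt_one
    ι ρ hchar h𝔓 hτ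
  rw [(hρ 𝔭 (hgood 𝔭 h𝔭good).1 (hgood 𝔭 h𝔭good).2.1 (hgood 𝔭 h𝔭good).2.2).2 𝔓 h𝔓 τ hτ] at h1
  refine ⟨α, hsat, ?_⟩
  have h2 : ι.symm (e (picardTrace f 𝔭)) = ι.symm α.sum := h1
  exact (ι.symm.injective h2).symm

end

end Summit.Langlands.Langlands.Theorems.IrregularClassicality.SlopeFreePolarizedLimit
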